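import Literature.Combinatorics.Matroid.FreeProductRankFormula
import Mathlib.Combinatorics.Matroid.Loop
import HarnessLib

/-!
# The free product is associative; loops and coloops of a free product (Crapo–Schmitt §4)

Source (held text `paper:arxiv-math_0409099`, statements VERBATIM; numbering of the arXiv version).
H. Crapo, W. Schmitt, *A unique factorization theorem for matroids*, J. Combin. Theory Ser. A **112**
(2005) 222–249 [CrapoSchmitt2005b], §4. Notation: `M = M(S)`, `N = N(T)`, `λ` rank-lack, `ν` nullity,
`A_S = A ∩ S`, `M □ N` the free product, `ρ` the rank.

«**Proposition 11.** Free product is an associative operation.»  («Proof. Suppose that `M = M(S)`,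
`N = N(T)` and `P = P(U)`. A set `A ⊆ S + T + U` is independent in `(M □ N) □ P` if and only if `A_{S+T}`
is independent in `M □ N` and `λ_{M□N}(A_{S+T}) ≥ ν_P(A_U)`. Since `A_{S+T}` is independent in `M □ N`, we
have `λ_{M□N}(A_{S+T}) = ρ(M □ N) − |A_{S+T}| = ρ(M) + ρ(N) − |A_S| − |A_T| = λ_M(A_S) + ρ(N) − |A_T|`.
Hence `A` is independent in `(M □ N) □ P` if and only if `A_S` is independent in `M`, `ν_N(A_T) ≤ λ_M(A_S)`
and `ν_P(A_U) ≤ λ_M(A_S) + ρ(N) − |A_T|`. […] these three conditions [are] `ν_M(A_S) ≤ 0`,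
`ν_N(A_T) ≤ λ_M(A_S)` and `ν_N(A_T) + ν_P(A_U) ≤ λ_M(A_S) + λ_N(A_T)`. On the other hand, `A` is
independent in `M □ (N □ P)` if and only if `ν_M(A_S) ≤ 0` and `ν_{N□P}(A_{T+U}) ≤ λ_M(A_S)`. By Equation
(null), the latter inequality may be written as `ν_N(A_T) + ν_P(A_U) ≤ λ_M(A_S) + min{λ_N(A_T), ν_P(A_U)}`,
which holds if and only if `ν_N(A_T) ≤ λ_M(A_S)` and `ν_N(A_T) + ν_P(A_U) ≤ λ_M(A_S) + λ_N(A_T)`. Hence `A`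
is independent in `M □ (N □ P)` if and only if it is independent in `(M □ N) □ P`.»)
«**Proposition 15.** For all matroids `M` and `N`, `loops(M) ⊆ loops(M □ N)`, with
`loops(M) = loops(M □ N)`, whenever `ρ(M) > 0`. Dually, `isthmuses(N) ⊆ isthmuses(M □ N)`, with equality
whenever `ν(N) > 0`.»  («Proof. If `x` is a loop of `M`, then `x` belongs to no independent set of
`M □ N` […]. On the other hand, suppose that `ρ(M) > 0`, and that `N = N(T)` and `x ∈ T`. It follows
from Proposition 4 that `ρ_{M□N}(x) = r_N(x) + min{ρ(M), ν_N(x)} = 1`, so `x` is not a loop in `M □ N`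
[…]. The dual statements follow directly from Proposition 10.»)
«**Corollary 16.** If `ρ(M) = 0` or `ν(N) = 0`, then `M □ N = M ⊕ N`.»

## What is formalised (finite rank, disjoint ground sets in one type; `freeProduct` of `FreeProduct.lean`,
the rank function `freeProduct_eRk_eq_min` of `FreeProductRankFormula.lean`)

* **Prop. 11** `freeProduct_assoc` (the printed comparison of the two independence conditions);
* **Prop. 15** element-wise: `freeProduct_isNonloop_iff_of_mem_left`, `freeProduct_isNonloop_iff_of_mem_right`
  (`x ∈ T` is a non-loop of `M □ N` iff `ρ(M) > 0` or `x` is a non-loop of `N`),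
  `freeProduct_isLoop_iff_of_mem_right`; dually (proved from the bases, Thm. 7.4.1, instead of
  Prop. 10) `freeProduct_isColoop_iff_of_mem_right`, `freeProduct_not_isColoop_of_mem_left`;
* **Cor. 16** `freeProduct_eq_disjointSum_of_eRank_eq_zero`, `freeProduct_eq_disjointSum_of_indep_ground`
  (from `freeProduct_eq_disjointSum_iff`).

All proved, no `sorry`.
-/

open Set
open scoped Matroid

namespace Literature.Combinatorics.Matroid

variable {α : Type*} {M₁ M₂ M₃ : Matroid α} {e : α}

/-! ### Plumbing -/

/-- Plumbing: `ℕ`-valued rank. [folklore] -/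
private noncomputable def nrk (M : Matroid α) (X : Set α) : ℕ := (M.eRk X).toNat

/-- Plumbing: `↑(nrk M X) = M.eRk X`. [folklore] -/
private theorem cast_nrk {M : Matroid α} [M.RankFinite] (X : Set α) : (nrk M X : ℕ∞) = M.eRk X :=
  ENat.coe_toNat (M.isRkFinite_set X).eRk_lt_top.ne

/-! ## Proposition 11: associativity -/

/-- **Crapo–Schmitt Prop. 11** «Free product is an associative operation»:
`(M₁ □ M₂) □ M₃ = M₁ □ (M₂ □ M₃)`. [cite: CrapoSchmitt2005b, Prop. 11] -/
theorem freeProduct_assoc [M₁.RankFinite] [M₂.RankFinite] [M₃.RankFinite]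
    (h₁₂ : Disjoint M₁.E M₂.E) (h₂₃ : Disjoint M₂.E M₃.E)
    [(freeProduct M₁ M₂ h₁₂).RankFinite] [(freeProduct M₂ M₃ h₂₃).RankFinite]
    (hL : Disjoint (freeProduct M₁ M₂ h₁₂).E M₃.E) (hR : Disjoint M₁.E (freeProduct M₂ M₃ h₂₃).E) :
    freeProduct (freeProduct M₁ M₂ h₁₂) M₃ hL = freeProduct M₁ (freeProduct M₂ M₃ h₂₃) hR := by
  haveI := freeProduct_rankFinite hL
  haveI := freeProduct_rankFinite hR
  refine Matroid.ext_indep (by simp only [freeProduct_ground, union_assoc]) fun A hA => ?_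
  by_cases hfin : A.Finite
  swap
  · exact iff_of_false (fun h => hfin h.finite) (fun h => hfin h.finite)
  have hA₁ : A ⊆ (M₁.E ∪ M₂.E) ∪ M₃.E := by simpa only [freeProduct_ground] using hA
  have hA₂ : A ⊆ M₁.E ∪ (M₂.E ∪ M₃.E) := by rw [← union_assoc]; exact hA₁
  have e12_1 : A ∩ (M₁.E ∪ M₂.E) ∩ M₁.E = A ∩ M₁.E := by
    rw [inter_assoc, inter_eq_self_of_subset_right subset_union_left]
  have e12_2 : A ∩ (M₁.E ∪ M₂.E) ∩ M₂.E = A ∩ M₂.E := by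
    rw [inter_assoc, inter_eq_self_of_subset_right subset_union_right]
  have e23_2 : A ∩ (M₂.E ∪ M₃.E) ∩ M₂.E = A ∩ M₂.E := by
    rw [inter_assoc, inter_eq_self_of_subset_right subset_union_left]
  have e23_3 : A ∩ (M₂.E ∪ M₃.E) ∩ M₃.E = A ∩ M₃.E := by
    rw [inter_assoc, inter_eq_self_of_subset_right subset_union_right]
  have c23 : (A ∩ (M₂.E ∪ M₃.E)).encard = (A ∩ M₂.E).encard + (A ∩ M₃.E).encard := by
    rw [inter_union_distrib_left, encard_union_eq (h₂₃.mono inter_subset_right inter_subset_right)]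
  -- the two independence conditions, via Prop. 7.4.6 and the rank function (Prop. 4)
  rw [freeProduct_indep_iff hL, freeProduct_ground h₁₂, freeProduct_indep_iff h₁₂, e12_1, e12_2,
    freeProduct_eRank h₁₂, freeProduct_eRk_eq_min h₁₂, e12_1, e12_2,
    freeProduct_indep_iff hR, freeProduct_ground h₂₃, c23, freeProduct_eRk_eq_min h₂₃, e23_2, e23_3]
  simp only [hA₁, hA₂, inter_subset_right, true_and]
  rw [and_assoc]
  refine and_congr_right fun _ => ?_
  -- «`ν_N(A_T) + ν_P(A_U) ≤ λ_M(A_S) + min{λ_N(A_T), ν_P(A_U)}` holds iff …»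
  rw [← min_add_add_right, min_le_iff, ← min_add_add_left, le_min_iff]
  have hf₂ : (A ∩ M₂.E).Finite := hfin.subset inter_subset_left
  have hf₃ : (A ∩ M₃.E).Finite := hfin.subset inter_subset_left
  rw [← hf₂.cast_ncard_eq, ← hf₃.cast_ncard_eq, Matroid.eRank_def, Matroid.eRank_def,
    ← cast_nrk (M := M₁) (A ∩ M₁.E), ← cast_nrk (M := M₁) M₁.E, ← cast_nrk (M := M₂) (A ∩ M₂.E),
    ← cast_nrk (M := M₂) M₂.E, ← cast_nrk (M := M₃) (A ∩ M₃.E)]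
  norm_cast
  constructor
  · rintro ⟨h1, h2 | h2⟩ <;> constructor <;> omega
  · rintro ⟨h1, h2⟩; constructor <;> omega

section LoopsColoops

variable [M₁.RankFinite] [M₂.RankFinite] (hE : Disjoint M₁.E M₂.E)

/-! ## Proposition 15: loops and isthmuses (coloops) -/

/-- On `E₁` the free product has the loops of `M₁` («`(M □ N)|S = M`»). [cite: CrapoSchmitt2005b, Prop. 15] -/
theorem freeProduct_isNonloop_iff_of_mem_left (he : e ∈ M₁.E) :
    (freeProduct M₁ M₂ hE).IsNonloop e ↔ M₁.IsNonloop e := by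
  rw [← Matroid.indep_singleton, freeProduct_indep_iff_of_subset_left hE (singleton_subset_iff.2 he),
    Matroid.indep_singleton]

/-- **Prop. 15** on `E₂`: «`ρ_{M□N}(x) = r_N(x) + min{ρ(M), ν_N(x)}`», so `x ∈ T` is a non-loop of `M □ N`
iff `ρ(M) > 0` or `x` is a non-loop of `N`. [cite: CrapoSchmitt2005b, Prop. 15] -/
theorem freeProduct_isNonloop_iff_of_mem_right (he : e ∈ M₂.E) :
    (freeProduct M₁ M₂ hE).IsNonloop e ↔ M₁.eRank ≠ 0 ∨ M₂.IsNonloop e := by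
  rw [← Matroid.indep_singleton, freeProduct_indep_iff_of_subset_right hE (singleton_subset_iff.2 he),
    encard_singleton]
  by_cases hl : M₂.IsNonloop e
  · rw [hl.eRk_eq]
    exact iff_of_true le_add_self (Or.inr hl)
  · rw [((Matroid.not_isNonloop_iff he).1 hl).eRk_eq, add_zero, Order.one_le_iff_ne_zero]
    simp only [hl, or_false]

/-- **Prop. 15** on `E₂`, loop form: `x ∈ T` is a loop of `M □ N` iff `ρ(M) = 0` and `x` is a loop of `N`;
in particular «`loops(M) = loops(M □ N)` whenever `ρ(M) > 0`». [cite: CrapoSchmitt2005b, Prop. 15] -/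
theorem freeProduct_isLoop_iff_of_mem_right (he : e ∈ M₂.E) :
    (freeProduct M₁ M₂ hE).IsLoop e ↔ M₁.eRank = 0 ∧ M₂.IsLoop e := by
  have he' : e ∈ (freeProduct M₁ M₂ hE).E := by rw [freeProduct_ground]; exact Or.inr he
  rw [← Matroid.not_isNonloop_iff he', freeProduct_isNonloop_iff_of_mem_right hE he, not_or, not_not,
    Matroid.not_isNonloop_iff he]

/-- **Prop. 15**: «`loops(M) ⊆ loops(M □ N)`» («if `x` is a loop of `M`, then `x` belongs to no independent
set of `M □ N`»). [cite: CrapoSchmitt2005b, Prop. 15] -/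
theorem freeProduct_isLoop_of_isLoop_left (h : M₁.IsLoop e) : (freeProduct M₁ M₂ hE).IsLoop e := by
  have he : e ∈ M₁.E := h.mem_ground
  have he' : e ∈ (freeProduct M₁ M₂ hE).E := by rw [freeProduct_ground]; exact Or.inl he
  rw [← Matroid.not_isNonloop_iff he', freeProduct_isNonloop_iff_of_mem_left hE he, Matroid.not_isNonloop_iff he]
  exact h

/-- **Prop. 15**, dual part on `E₂`: `x ∈ T` is an isthmus (coloop) of `M □ N` iff it is one of `N`
(every base of `M □ N` meets `T` in a spanning set of `N`; `B₁ ∪ B₂` is a base).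
[cite: CrapoSchmitt2005b, Prop. 15] -/
theorem freeProduct_isColoop_iff_of_mem_right (he : e ∈ M₂.E) :
    (freeProduct M₁ M₂ hE).IsColoop e ↔ M₂.IsColoop e := by
  rw [Matroid.isColoop_iff_forall_mem_isBase, Matroid.isColoop_iff_forall_mem_isBase]
  constructor
  · intro h B₂ hB₂
    obtain ⟨B₁, hB₁⟩ := M₁.exists_isBase
    rcases h (union_isBase_freeProduct hE hB₁ hB₂) with h1 | h2
    · exact absurd he (hE.notMem_of_mem_left (hB₁.subset_ground h1))
    · exact h2
  · intro h B hB
    obtain ⟨-, -, hsp, -⟩ := (freeProduct_isBase_iff hE).1 hB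
    obtain ⟨B₂, hB₂, hB₂B⟩ := hsp.exists_isBase_subset
    exact (hB₂B (h hB₂)).1

/-- **Prop. 15**, dual part on `E₁`: if `ν(N) > 0` (i.e. `N` is not free) then no element of `S` is an
isthmus of `M □ N` (exchange `e ∈ B₁` against an element of `T − B₂`). [cite: CrapoSchmitt2005b, Prop. 15] -/
theorem freeProduct_not_isColoop_of_mem_left (he : e ∈ M₁.E) (hN : ¬ M₂.Indep M₂.E) :
    ¬ (freeProduct M₁ M₂ hE).IsColoop e := by
  rw [Matroid.isColoop_iff_forall_mem_isBase]
  intro h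
  obtain ⟨B₁, hB₁⟩ := M₁.exists_isBase
  obtain ⟨B₂, hB₂⟩ := M₂.exists_isBase
  have he₂ : e ∉ M₂.E := fun h' => hE.notMem_of_mem_left he h'
  -- an element `t ∈ T − B₂` (as `N` is not free)
  obtain ⟨t, ht, htB₂⟩ : ∃ t ∈ M₂.E, t ∉ B₂ := by
    by_contra! hall
    exact hN (hB₂.indep.subset hall)
  by_cases heB₁ : e ∈ B₁
  swap
  · rcases h (union_isBase_freeProduct hE hB₁ hB₂) with h1 | h2
    · exact heB₁ h1
    · exact he₂ (hB₂.subset_ground h2)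
  -- the base `((B₁ ∪ B₂) − e) ∪ t`
  have hB : FreeProductBase M₁ M₂ (B₁ ∪ B₂) := freeProductBase_union hE hB₁ hB₂
  have htB : t ∉ B₁ ∪ B₂ := fun h' => h'.elim (fun h1 => hE.notMem_of_mem_left (hB₁.subset_ground h1) ht) htB₂
  have h1 : insert t ((B₁ ∪ B₂) \ {e}) ∩ M₁.E = B₁ \ {e} := by
    rw [insert_inter_of_notMem (fun h' => hE.notMem_of_mem_left h' ht), union_sdiff_distrib,
      union_inter_distrib_right, inter_eq_self_of_subset_left (sdiff_subset.trans hB₁.subset_ground),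
      ((hE.symm.mono_left (sdiff_subset.trans hB₂.subset_ground))).inter_eq, union_empty]
  have h2 : insert t ((B₁ ∪ B₂) \ {e}) ∩ M₂.E = insert t B₂ := by
    rw [insert_inter_of_mem ht, union_sdiff_distrib, union_inter_distrib_right,
      (hE.mono_left (sdiff_subset.trans hB₁.subset_ground)).inter_eq, empty_union,
      sdiff_singleton_eq_self (fun h' => he₂ (hB₂.subset_ground h')),
      inter_eq_self_of_subset_left hB₂.subset_ground]
  have hB' : FreeProductBase M₁ M₂ (insert t ((B₁ ∪ B₂) \ {e})) :=
    freeProductBase_insert_sdiff hB (Or.inl heB₁) htB (Or.inr ht)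
      (by rw [h1]; exact hB₁.indep.subset sdiff_subset)
      (by rw [h2]; exact hB₂.spanning.superset (subset_insert _ _) (insert_subset ht hB₂.subset_ground))
  rcases h ((freeProduct_isBase_iff hE).2 hB') with h3 | h3
  · exact hE.notMem_of_mem_left he (h3 ▸ ht)
  · exact h3.2 rfl

/-! ## Corollary 16 -/

/-- **Crapo–Schmitt Cor. 16**: «If `ρ(M) = 0` […] then `M □ N = M ⊕ N`.» [cite: CrapoSchmitt2005b, Cor. 16] -/
theorem freeProduct_eq_disjointSum_of_eRank_eq_zero (h : M₁.eRank = 0) :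
    freeProduct M₁ M₂ hE = M₁.disjointSum M₂ hE :=
  (freeProduct_eq_disjointSum_iff hE).2 (Or.inl (Matroid.eRank_eq_zero_iff.1 h))

/-- **Crapo–Schmitt Cor. 16**: «If […] `ν(N) = 0`, then `M □ N = M ⊕ N`.» [cite: CrapoSchmitt2005b, Cor. 16] -/
theorem freeProduct_eq_disjointSum_of_indep_ground (h : M₂.Indep M₂.E) :
    freeProduct M₁ M₂ hE = M₁.disjointSum M₂ hE :=
  (freeProduct_eq_disjointSum_iff hE).2 (Or.inr (Matroid.eq_freeOn_iff.2 ⟨rfl, h⟩))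

end LoopsColoops

end Literature.Combinatorics.Matroid
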